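import Mathlib
import Literature.Combinatorics.Optimization.UniqueGamesLpHardness
import HarnessLib

/-!
# Charikar–Makarychev–Makarychev Theorem 6.1: the Unique Games gap FROM its MAX 2LIN(2) ingredient
# (the "parallel-repetition-like" product step of the printed proof sketch) — PROVED

[topic Combinatorics/Optimization]

The tree's named fact `CharikarMakarychevMakarychev2009_uniqueGamesSA` (`UniqueGamesLpHardness.lean`;
CMM STOC 2009 Thm 6.1 in Lee–Raghavendra–Steurer's pseudo-density currency) comes in print with a proof
SKETCH (p. 13–14, held text `paper:doi-10-1145-1536414-1536455`):

> "The labels are elements of the multiplicative group `{−1,1}^t`. For every edge `(u,v)` of the graph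
> we pick independently (and uniformly) a random element `π_{uv}` in `{−1,1}^t`. The constraint between
> `u` and `v` is `Λ(u) = Λ(v) · π_{uv}`.  By the standard probabilistic argument, for sufficiently large
> `C` the optimal solution of the Unique Games problem has value at most `(1 + δ)/q` …  We now need to
> show that the LP cost of the Unique Game is at least `(1 − ε)`. Fix `s` from `0` to `t − 1` and
> consider `s`-th coordinate of every label, and `s`-th coordinate of every `π_{uv}`. We get an instance
> of MAX 2LIN mod 2 … It is easy to see, that Theorem 5.3 works not only for MAX CUT, but also for
> MAX 2LIN … The theorem guarantees that for every set `S` of size at most `Ω(r)` there exists a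
> distribution of cuts such that if `π^s_{uv} = 1`, then `u` and `v` lie on the same side of the cut;
> and if `π^s_{uv} = −1`, then `u` and `v` lie on the opposite sides of the cut with probability
> `1 − ε`. Define `Λ^s(u)` to be `−1` or `1` depending on whether `u` belongs to the cut or not. Then
> `Λ^s(u) = π^s_{uv} · Λ^s(v)` with probability at least `1 − ε/k` [sic: `ε/t`] … Thus by the union
> bound, `Λ(u) = π_{uv} · Λ(v)` with probability `(1 − ε)`. This concludes the proof."

This file PROVES the last step of that sketch — everything after "Theorem 5.3 works … for MAX 2LIN"
and the soundness computation — as a theorem whose hypothesis is exactly the proof state reached there: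
**`CharikarMakarychevMakarychev2009_uniqueGamesSA_of_twoLin`**: if for every `t ≥ 1`, `δ ∈ (0,1)`,
`ε > 0` there are `γ > 0`, `n₀` such that for every `n ≥ n₀` there is ONE constraint graph
(`M ≥ 1` pairs `u_i ≠ v_i` on `[n]`) with sign patterns `π_i ∈ {0,1}^t` such that (i) [soundness of the
combined Unique Game, labels `{0,1}^t`, constraints `Λ(v_i) = Λ(u_i) ⊕ π_i`] every labelling satisfies
at most a `(1+δ)/2^t` fraction of the constraints, and (ii) [the MAX 2LIN(2) Sherali–Adams solutions]
for every coordinate `s < t` there is a `⌊n^γ⌋`-local pseudo-density `D_s` on `{0,1}ⁿ` (uniform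
measure) under which every equation `x_{v_i} = x_{u_i} ⊕ π_i(s)` holds with pseudo-probability
`≥ 1 − ε/t`, THEN `CharikarMakarychevMakarychev2009_uniqueGamesSA` holds.  The construction is the
printed one: labels `{0,1}^t ≃ [2^t]` (`labelEquiv`), XOR constraints as bijections (`xorShift`,
`ugPerm`, `ugOfXor`), the PRODUCT pseudo-density `D(x) = ∏_s D_s(x^{(s)})` over the `t` coordinate
slices (`prodDensity`; it is `d`-local: tested against a cylinder `𝟙[x_T = p]` it factors into the
`t` nonnegative numbers `E[D_s 𝟙[x^{(s)}_T = p^{(s)}]]`, `isLocalPseudoDensity_prodDensity`, and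
nonnegative `T`-juntas are nonnegative combinations of cylinders, `IsSJunta.eq_sum_cylinderFn`), the
factorisation of the uniform measure on `([2^t])ⁿ ≃ ({0,1}ⁿ)^t` (`muExpect_prod_coordOf`), and the
union bound in product form `∏_s (1 − ε/t) ≥ 1 − ε` (Bernoulli).  So what remains unproved behind the
fact is precisely CMM's signed variant of their Theorem 5.3 ("works … also for MAX 2LIN") together with
the random choice of `(G, π)`; the MAX-CUT case of Theorem 5.3 is PROVED in the tree
(`CharikarMakarychevMakarychev2009_maxCutSA_holds`).  0 named facts; no `sorry`.

## References

* [CharikarMakarychevMakarychev2009] M. Charikar, K. Makarychev, Y. Makarychev, *Integrality gaps for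
  Sherali–Adams relaxations*, STOC 2009; §6, Thm 6.1 and its proof sketch (p. 13–14).
* [LeeRaghavendraSteurer2015] J. R. Lee, P. Raghavendra, D. Steurer, STOC 2015, arXiv:1411.6317; §7.1
  (`d`-local pseudo-densities, p. 27), Thm 7.6 (p. 29).
-/

noncomputable section

open Finset

namespace Literature.Combinatorics.Optimization

namespace UGFromTwoLin

variable {t n : ℕ}

/-! ### Labels `{0,1}^t ≃ [2^t]`, coordinate slices, XOR constraints -/

/-- The identification of the label group `{0,1}^t` (CMM: `{−1,1}^t`) with `[q]`, `q = 2^t`.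
[cite: CharikarMakarychevMakarychev2009, Thm 6.1 proof (p. 13: "The labels are elements of the multiplicative group {−1,1}^t")] -/
def labelEquiv (t : ℕ) : (Fin t → Bool) ≃ Fin (2 ^ t) :=
  Fintype.equivFinOfCardEq (by simp)

/-- The `s`-th coordinate slice `x^{(s)} ∈ {0,1}ⁿ` of a labelling `x ∈ [2^t]ⁿ`
("consider `s`-th coordinate of every label"). [cite: CharikarMakarychevMakarychev2009, Thm 6.1 proof (p. 13)] -/
def coordOf (x : Fin n → Fin (2 ^ t)) (s : Fin t) : Fin n → Bool :=
  fun w => (labelEquiv t).symm (x w) s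

/-- All the slices at once: `[2^t]ⁿ ≃ ({0,1}ⁿ)^t`. [cite: CharikarMakarychevMakarychev2009, Thm 6.1 proof (p. 13)] -/
def slices (t n : ℕ) : (Fin n → Fin (2 ^ t)) ≃ (Fin t → Fin n → Bool) :=
  (Equiv.arrowCongr (Equiv.refl (Fin n)) (labelEquiv t).symm).trans (Equiv.piComm _)

/-- `slices x s = x^{(s)}`. [cite: CharikarMakarychevMakarychev2009, Thm 6.1 proof (p. 13)] -/
@[simp] theorem slices_apply (x : Fin n → Fin (2 ^ t)) (s : Fin t) : slices t n x s = coordOf x s := rfl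

/-- The XOR shift `ℓ ↦ ℓ ⊕ π` of `{0,1}^t` (CMM's `Λ ↦ Λ · π`), an involution.
[cite: CharikarMakarychevMakarychev2009, Thm 6.1 proof (p. 13: "The constraint between u and v is Λ(u) = Λ(v)·π_{uv}")] -/
def xorShift (π : Fin t → Bool) : Equiv.Perm (Fin t → Bool) :=
  Function.Involutive.toPerm (fun ℓ s => xor (ℓ s) (π s)) (by intro ℓ; funext s; simp)

/-- `xorShift π ℓ s = ℓ s ⊕ π s`. [cite: CharikarMakarychevMakarychev2009, Thm 6.1 proof (p. 13)] -/
@[simp] theorem xorShift_apply (π ℓ : Fin t → Bool) (s : Fin t) : xorShift π ℓ s = xor (ℓ s) (π s) := rfl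

/-- The XOR constraint as a bijection of `[2^t]`. [cite: CharikarMakarychevMakarychev2009, Thm 6.1 proof (p. 13)] -/
def ugPerm (t : ℕ) (π : Fin t → Bool) : Equiv.Perm (Fin (2 ^ t)) :=
  ((labelEquiv t).symm.trans (xorShift π)).trans (labelEquiv t)

/-- `b = ugPerm π a` iff the label vectors satisfy `b = a ⊕ π` coordinatewise.
[cite: CharikarMakarychevMakarychev2009, Thm 6.1 proof (p. 13)] -/
theorem eq_ugPerm_iff (π : Fin t → Bool) (a b : Fin (2 ^ t)) :
    b = ugPerm t π a ↔ ∀ s, (labelEquiv t).symm b s = xor ((labelEquiv t).symm a s) (π s) := by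
  constructor
  · intro h s
    subst h
    simp [ugPerm]
  · intro h
    have h' : (labelEquiv t).symm b = xorShift π ((labelEquiv t).symm a) := funext h
    calc b = labelEquiv t ((labelEquiv t).symm b) := by simp
      _ = ugPerm t π a := by rw [h']; simp [ugPerm]

/-- **The Unique Game of a MAX 2LIN(2)^t system**: constraints `Λ(v_i) = Λ(u_i) ⊕ π_i` on the pairs
`(u_i, v_i)`, labels `[2^t]`. [cite: CharikarMakarychevMakarychev2009, Thm 6.1 proof (p. 13)] -/
def ugOfXor {M : ℕ} (hM : 0 < M) (u v : Fin M → Fin n) (huv : ∀ i, u i ≠ v i)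
    (π : Fin M → Fin t → Bool) : UGInstance (2 ^ t) n :=
  ⟨M, hM, fun i => ⟨u i, v i, huv i, ugPerm t (π i)⟩⟩

/-- The value of the Unique Game of a MAX 2LIN(2)^t system, unfolded.
[cite: CharikarMakarychevMakarychev2009, Thm 6.1 proof (p. 13)] -/
theorem ugOfXor_val {M : ℕ} (hM : 0 < M) (u v : Fin M → Fin n) (huv : ∀ i, u i ≠ v i)
    (π : Fin M → Fin t → Bool) (x : Fin n → Fin (2 ^ t)) :
    (ugOfXor hM u v huv π).val x =
      (∑ i : Fin M, if x (v i) = ugPerm t (π i) (x (u i)) then (1 : ℝ) else 0) / (M : ℝ) := rfl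

/-- The satisfaction indicator of the `i`-th constraint FACTORS over the coordinates:
`𝟙[x_{v} = x_{u} ⊕ π] = ∏_s 𝟙[x^{(s)}_v = x^{(s)}_u ⊕ π(s)]`. [cite: CharikarMakarychevMakarychev2009, Thm 6.1 proof (p. 13–14: "Λ^s(u) = π^s_{uv}·Λ^s(v) … by the union bound")] -/
theorem sat_indicator_eq_prod (π : Fin t → Bool) (a b : Fin n) (x : Fin n → Fin (2 ^ t)) :
    (if x b = ugPerm t π (x a) then (1 : ℝ) else 0) =
      ∏ s : Fin t, (if coordOf x s b = xor (coordOf x s a) (π s) then (1 : ℝ) else 0) := by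
  rw [Finset.prod_boole]
  have hiff : x b = ugPerm t π (x a) ↔ ∀ s, coordOf x s b = xor (coordOf x s a) (π s) := by
    rw [eq_ugPerm_iff]
    rfl
  by_cases h : x b = ugPerm t π (x a)
  · rw [if_pos h, if_pos (by simpa using hiff.1 h)]
  · rw [if_neg h, if_neg (by simpa using fun h' => h (hiff.2 h'))]

/-- **Soundness transfers**: if every `{0,1}^t`-labelling `L` satisfies at most `s₀·M` of the XOR
constraints `L(v_i) = L(u_i) ⊕ π_i`, then `opt ≤ s₀` for the Unique Game over `[2^t]`.
[cite: CharikarMakarychevMakarychev2009, Thm 6.1 (i) (p. 13)] -/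
theorem ugOfXor_optLE {M : ℕ} (hM : 0 < M) (u v : Fin M → Fin n) (huv : ∀ i, u i ≠ v i)
    (π : Fin M → Fin t → Bool) {s₀ : ℝ}
    (hsound : ∀ L : Fin n → Fin t → Bool,
      (∑ i, if L (v i) = (fun s => xor (L (u i) s) (π i s)) then (1 : ℝ) else 0) ≤ s₀ * M) :
    (ugOfXor hM u v huv π).OptLE s₀ := by
  intro x
  have hMpos : (0 : ℝ) < M := by exact_mod_cast hM
  rw [ugOfXor_val, div_le_iff₀ hMpos]
  refine le_trans (le_of_eq ?_) (hsound (fun w => (labelEquiv t).symm (x w)))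
  refine sum_congr rfl fun i _ => ?_
  have hiff : x (v i) = ugPerm t (π i) (x (u i)) ↔
      (fun s => (labelEquiv t).symm (x (v i)) s) =
        fun s => xor ((labelEquiv t).symm (x (u i)) s) (π i s) := by
    rw [eq_ugPerm_iff, funext_iff]
  by_cases h : x (v i) = ugPerm t (π i) (x (u i))
  · rw [if_pos h, if_pos (hiff.1 h)]
  · rw [if_neg h, if_neg (fun h' => h (hiff.2 h'))]

/-! ### The uniform measure on `[2^t]ⁿ` factors over the coordinate slices -/

/-- `E_μ g` for a constant (uniform) weight. [cite: LeeRaghavendraSteurer2015, §7.1 (arXiv p. 27: uniform measure)] -/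
theorem muExpect_uniformWeight {ι X : Type*} [Fintype ι] [DecidableEq ι] [Fintype X] (g : (ι → X) → ℝ) :
    muExpect (uniformWeight ι X) g = (∑ x, g x) / Fintype.card (ι → X) := by
  simp only [muExpect, uniformWeight]
  rw [sum_div]
  refine sum_congr rfl fun x _ => ?_
  ring

/-- **Fubini over the slices**: for functions `f_s` on `{0,1}ⁿ`,
`E_{x ∈ [2^t]ⁿ} ∏_s f_s(x^{(s)}) = ∏_s E_{y ∈ {0,1}ⁿ} f_s(y)` (uniform measures).
[cite: CharikarMakarychevMakarychev2009, Thm 6.1 proof (p. 13: "we pick independently (and uniformly)")] -/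
theorem muExpect_prod_coordOf (f : Fin t → (Fin n → Bool) → ℝ) :
    muExpect (uniformWeight (Fin n) (Fin (2 ^ t))) (fun x => ∏ s, f s (coordOf x s)) =
      ∏ s, muExpect (uniformWeight (Fin n) Bool) (f s) := by
  rw [muExpect_uniformWeight,
    prod_congr rfl (fun s (_ : s ∈ (univ : Finset (Fin t))) => muExpect_uniformWeight (f s))]
  -- the sum over `[2^t]ⁿ` as a sum over `({0,1}ⁿ)^t`
  have h1 : ∑ x : Fin n → Fin (2 ^ t), ∏ s, f s (coordOf x s) =
      ∑ z : Fin t → Fin n → Bool, ∏ s, f s (z s) :=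
    Fintype.sum_equiv (slices t n) _ _ fun x => by simp
  have h2 : ∑ z : Fin t → Fin n → Bool, ∏ s, f s (z s) = ∏ s : Fin t, ∑ y : Fin n → Bool, f s y := by
    rw [Finset.prod_univ_sum (fun _ : Fin t => (univ : Finset (Fin n → Bool))) (fun s y => f s y),
      Fintype.piFinset_univ]
  rw [h1, h2, Finset.prod_div_distrib]
  congr 1
  rw [prod_const, card_univ, Fintype.card_fin]
  simp only [Fintype.card_fun, Fintype.card_fin, Fintype.card_bool]
  push_cast
  rw [← pow_mul, ← pow_mul, mul_comm]

/-! ### The product pseudo-density -/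

/-- **The product pseudo-density** `D(x) = ∏_s D_s(x^{(s)})` on `[2^t]ⁿ` (the law of
`Λ(u) = (Λ^s(u))_s` with independent coordinates). [cite: CharikarMakarychevMakarychev2009, Thm 6.1 proof (p. 13–14: "Define Λ^s(u) …")] -/
def prodDensity (D : Fin t → (Fin n → Bool) → ℝ) : (Fin n → Fin (2 ^ t)) → ℝ :=
  fun x => ∏ s, D s (coordOf x s)

/-- A cylinder `𝟙[x_T = p]` on `[2^t]ⁿ` factors into the cylinders of the slices.
[cite: CharikarMakarychevMakarychev2009, Thm 6.1 proof (p. 13)] -/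
theorem cylinderFn_eq_prod (T : Finset (Fin n)) (p : T → Fin (2 ^ t)) (x : Fin n → Fin (2 ^ t)) :
    cylinderFn T p x = ∏ s : Fin t, cylinderFn T (fun i => (labelEquiv t).symm (p i) s) (coordOf x s) := by
  simp only [cylinderFn]
  rw [Finset.prod_boole]
  have hiff : (∀ i : T, x i = p i) ↔ ∀ s : Fin t, ∀ i : T, coordOf x s i = (labelEquiv t).symm (p i) s := by
    constructor
    · intro h s i; simp [coordOf, h i]
    · intro h i
      apply (labelEquiv t).symm.injective
      funext s
      exact h s i
  by_cases h : ∀ i : T, x i = p i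
  · rw [if_pos h, if_pos (by simpa using hiff.1 h)]
  · rw [if_neg h, if_neg (by simpa using fun h' => h (hiff.2 h'))]

/-- **The product of `d`-local pseudo-densities is a `d`-local pseudo-density** (on `[2^t]ⁿ`, uniform
measure): `E D = ∏ E D_s = 1`, and against a nonnegative `T`-junta, `|T| ≤ d`, decomposed into cylinders
(`IsSJunta.eq_sum_cylinderFn`), each cylinder term factors into `∏_s E[D_s 𝟙[x^{(s)}_T = p^{(s)}]] ≥ 0`.
[cite: CharikarMakarychevMakarychev2009, Thm 6.1 proof (p. 13–14)] [cite: LeeRaghavendraSteurer2015, §7.1 (arXiv p. 27)] -/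
theorem isLocalPseudoDensity_prodDensity {d : ℕ} {D : Fin t → (Fin n → Bool) → ℝ}
    (hD : ∀ s, IsLocalPseudoDensity (uniformWeight (Fin n) Bool) d (D s)) :
    IsLocalPseudoDensity (uniformWeight (Fin n) (Fin (2 ^ t))) d (prodDensity D) := by
  refine ⟨?_, fun g hg hg0 => ?_⟩
  · show muExpect (uniformWeight (Fin n) (Fin (2 ^ t))) (fun x => ∏ s, D s (coordOf x s)) = 1
    rw [muExpect_prod_coordOf (n := n) (t := t) D]
    exact prod_eq_one fun s _ => (hD s).1
  · obtain ⟨T, hT, hgT⟩ := hg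
    let x₀ : Fin n → Fin (2 ^ t) := fun _ => ⟨0, pow_pos (by norm_num) t⟩
    -- decompose `g` into cylinders
    have hdec : (fun x => prodDensity D x * g x) =
        fun x => ∑ p : T → Fin (2 ^ t), g (extendPattern T p x₀) * (prodDensity D x * cylinderFn T p x) := by
      funext x
      rw [hgT.eq_sum_cylinderFn x₀ x, mul_sum]
      refine sum_congr rfl fun p _ => ?_
      ring
    rw [hdec]
    -- linearity of `E`
    have hlin : muExpect (uniformWeight (Fin n) (Fin (2 ^ t)))
        (fun x => ∑ p : T → Fin (2 ^ t), g (extendPattern T p x₀) * (prodDensity D x * cylinderFn T p x)) =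
        ∑ p : T → Fin (2 ^ t), g (extendPattern T p x₀) *
          muExpect (uniformWeight (Fin n) (Fin (2 ^ t))) (fun x => prodDensity D x * cylinderFn T p x) := by
      simp only [muExpect, mul_sum]
      rw [sum_comm]
      refine sum_congr rfl fun p _ => ?_
      refine sum_congr rfl fun x _ => ?_
      ring
    rw [hlin]
    refine sum_nonneg fun p _ => mul_nonneg (hg0 _) ?_
    -- each cylinder term factors
    have hfac : (fun x => prodDensity D x * cylinderFn T p x) =
        fun x => ∏ s, (D s (coordOf x s) * cylinderFn T (fun i => (labelEquiv t).symm (p i) s) (coordOf x s)) := by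
      funext x
      rw [prodDensity, cylinderFn_eq_prod, ← prod_mul_distrib]
    rw [hfac, muExpect_prod_coordOf (fun s y => D s y * cylinderFn T (fun i => (labelEquiv t).symm (p i) s) y)]
    exact prod_nonneg fun s _ => (hD s).2 _ ⟨T, hT, isSJunta_cylinderFn T _⟩ (cylinderFn_nonneg T _)

/-- **Bernoulli / union bound in product form**: `0 ≤ a ≤ 1`, `a ≤ p_s` ⇒ `∏_{s<t} p_s ≥ 1 − t(1 − a)`;
used with `a = 1 − ε/t`: `∏ p_s ≥ 1 − ε`. [cite: CharikarMakarychevMakarychev2009, Thm 6.1 proof (p. 14: "by the union bound")] -/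
theorem one_sub_le_prod {t : ℕ} {ε : ℝ} (hε : 0 ≤ ε) (hεt : ε ≤ t) {p : Fin t → ℝ}
    (hp : ∀ s, 1 - ε / t ≤ p s) : 1 - ε ≤ ∏ s, p s := by
  rcases Nat.eq_zero_or_pos t with rfl | htpos
  · have : ε = 0 := le_antisymm (by simpa using hεt) hε
    simp [this]
  have ht : (0 : ℝ) < t := by exact_mod_cast htpos
  have ha0 : 0 ≤ 1 - ε / t := by
    rw [sub_nonneg, div_le_one ht]; exact hεt
  calc 1 - ε = 1 + (t : ℝ) * (-(ε / t)) := by field_simp; ring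
    _ ≤ (1 + (-(ε / t))) ^ t := one_add_mul_le_pow (by
        have : ε / t ≤ 1 := by rw [div_le_one ht]; exact hεt
        linarith) t
    _ = ∏ _s : Fin t, (1 - ε / t) := by rw [prod_const, card_univ, Fintype.card_fin]; ring
    _ ≤ ∏ s, p s := prod_le_prod (fun s _ => ha0) (fun s _ => hp s)

/-- **The value of the product pseudo-density on the Unique Game**: if under `D_s` every equation
`x_{v_i} = x_{u_i} ⊕ π_i(s)` has pseudo-probability `≥ 1 − ε/t` (`0 ≤ ε ≤ t`), then
`E[D · ℑ] ≥ 1 − ε`. [cite: CharikarMakarychevMakarychev2009, Thm 6.1 proof (p. 14: "Thus by the union bound, Λ(u) = π_{uv}·Λ(v) with probability (1 − ε)")] -/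
theorem muExpect_prodDensity_val {M : ℕ} (hM : 0 < M) (u v : Fin M → Fin n) (huv : ∀ i, u i ≠ v i)
    (π : Fin M → Fin t → Bool) {D : Fin t → (Fin n → Bool) → ℝ} {ε : ℝ} (hε : 0 ≤ ε) (hεt : ε ≤ t)
    (hval : ∀ s i, 1 - ε / t ≤ muExpect (uniformWeight (Fin n) Bool)
      (fun y => D s y * (if y (v i) = xor (y (u i)) (π i s) then (1 : ℝ) else 0))) :
    1 - ε ≤ muExpect (uniformWeight (Fin n) (Fin (2 ^ t)))
      (fun x => prodDensity D x * (ugOfXor hM u v huv π).val x) := by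
  set μ := uniformWeight (Fin n) (Fin (2 ^ t)) with hμ
  set sI : Fin M → (Fin n → Fin (2 ^ t)) → ℝ :=
    fun i x => if x (v i) = ugPerm t (π i) (x (u i)) then (1 : ℝ) else 0 with hsI
  have hMpos : (0 : ℝ) < M := by exact_mod_cast hM
  have hvalx : ∀ x, (ugOfXor hM u v huv π).val x = (∑ i, sI i x) / (M : ℝ) :=
    fun x => ugOfXor_val hM u v huv π x
  -- linearity
  have hlin : muExpect μ (fun x => prodDensity D x * (ugOfXor hM u v huv π).val x) =
      (∑ i, muExpect μ (fun x => prodDensity D x * sI i x)) / (M : ℝ) := by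
    simp only [muExpect, hvalx]
    have e1 : ∀ x, μ x * (prodDensity D x * ((∑ i, sI i x) / (M : ℝ))) =
        ∑ i, μ x * (prodDensity D x * sI i x) / (M : ℝ) := by
      intro x
      rw [← sum_div, ← mul_sum, ← mul_sum]
      ring
    simp_rw [e1]
    simp only [← sum_div]
    rw [sum_comm]
  rw [hlin, le_div_iff₀ hMpos]
  -- each constraint: factorisation and the union bound
  have hi : ∀ i, 1 - ε ≤ muExpect μ (fun x => prodDensity D x * sI i x) := by
    intro i
    have hfac : (fun x => prodDensity D x * sI i x) = fun x => ∏ s,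
        (D s (coordOf x s) *
          (if coordOf x s (v i) = xor (coordOf x s (u i)) (π i s) then (1 : ℝ) else 0)) := by
      funext x
      show prodDensity D x * (if x (v i) = ugPerm t (π i) (x (u i)) then (1 : ℝ) else 0) = _
      simp only [prodDensity]
      rw [sat_indicator_eq_prod (π i) (u i) (v i) x, ← prod_mul_distrib]
    rw [hfac, hμ, muExpect_prod_coordOf
      (fun s y => D s y * (if y (v i) = xor (y (u i)) (π i s) then (1 : ℝ) else 0))]
    exact one_sub_le_prod hε hεt fun s => hval s i
  calc (1 - ε) * (M : ℝ) = ∑ _i : Fin M, (1 - ε) := by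
        rw [sum_const, card_univ, Fintype.card_fin, nsmul_eq_mul]; ring
    _ ≤ ∑ i, muExpect μ (fun x => prodDensity D x * sI i x) := sum_le_sum fun i _ => hi i

end UGFromTwoLin

open UGFromTwoLin

/-- **Charikar–Makarychev–Makarychev Theorem 6.1 from its MAX 2LIN(2) ingredient** (the product /
"parallel-repetition-like" step of the printed proof sketch, p. 13–14, PROVED).  Hypothesis = the proof
state after "Theorem 5.3 works … also for MAX 2LIN" and the soundness computation: for every `t ≥ 1`,
`δ ∈ (0,1)`, `ε > 0` there are `γ > 0` and `n₀` such that for every `n ≥ n₀` some constraint graph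
(`M ≥ 1` pairs `u_i ≠ v_i` of variables) with sign patterns `π_i ∈ {0,1}^t` has (i) every labelling
`L : [n] → {0,1}^t` satisfying at most `(1+δ)M/2^t` of the constraints `L(v_i) = L(u_i) ⊕ π_i`, and
(ii) for every coordinate `s < t` a `⌊n^γ⌋`-local pseudo-density `D_s` on `{0,1}ⁿ` (uniform measure)
giving every equation `x_{v_i} = x_{u_i} ⊕ π_i(s)` pseudo-probability `≥ 1 − ε/t`.  Conclusion: the
tree's fact `CharikarMakarychevMakarychev2009_uniqueGamesSA` (with the Unique Game `ugOfXor` over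
`[2^t]` and the product pseudo-density `prodDensity D`).
[cite: CharikarMakarychevMakarychev2009, Thm 6.1 and its proof sketch (p. 13–14)]
[cite: LeeRaghavendraSteurer2015, Thm 7.6 (arXiv p. 29)] -/
theorem CharikarMakarychevMakarychev2009_uniqueGamesSA_of_twoLin
    (h : ∀ t : ℕ, 1 ≤ t → ∀ δ : ℝ, 0 < δ → δ < 1 → ∀ ε : ℝ, 0 < ε →
      ∃ γ : ℝ, 0 < γ ∧ ∃ n₀ : ℕ, ∀ n : ℕ, n₀ ≤ n →
        ∃ (M : ℕ) (_ : 0 < M) (u v : Fin M → Fin n) (_ : ∀ i, u i ≠ v i) (π : Fin M → Fin t → Bool),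
          (∀ L : Fin n → Fin t → Bool,
            (∑ i, if L (v i) = (fun s => xor (L (u i) s) (π i s)) then (1 : ℝ) else 0) ≤
              (1 + δ) / 2 ^ t * M) ∧
          ∀ s : Fin t, ∃ D : (Fin n → Bool) → ℝ,
            IsLocalPseudoDensity (uniformWeight (Fin n) Bool) ⌊(n : ℝ) ^ γ⌋₊ D ∧
            ∀ i, 1 - ε / t ≤ muExpect (uniformWeight (Fin n) Bool)
              (fun y => D y * (if y (v i) = xor (y (u i)) (π i s) then (1 : ℝ) else 0))) :
    CharikarMakarychevMakarychev2009_uniqueGamesSA := by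
  intro t ht δ hδ hδ1 ε hε
  -- WLOG `ε ≤ 1 ≤ t`
  set ε' : ℝ := min ε 1 with hε'
  have hε'0 : 0 < ε' := lt_min hε one_pos
  have hε'ε : ε' ≤ ε := min_le_left _ _
  have hε't : ε' ≤ t := le_trans (min_le_right _ _) (by exact_mod_cast ht)
  obtain ⟨γ, hγ, n₀, hn₀⟩ := h t ht δ hδ hδ1 ε' hε'0
  refine ⟨γ, hγ, n₀, fun n hn => ?_⟩
  obtain ⟨M, hM, u, v, huv, π, hsound, hSA⟩ := hn₀ n hn
  choose D hD hval using hSA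
  refine ⟨ugOfXor hM u v huv π, ugOfXor_optLE hM u v huv π hsound, prodDensity D,
    isLocalPseudoDensity_prodDensity hD, ?_⟩
  have hmain := muExpect_prodDensity_val hM u v huv π (D := D) hε'0.le hε't (fun s i => hval s i)
  linarith

end Literature.Combinatorics.Optimization
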